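import Summits.QuantumFields.BalabanUV.Beta.GAN24.LayerPushGaugeLeg

/-!
# `BalabanUV.Beta.GAN24.LayerPushGaugeLeft` — binder row G-an2-4 / (CONV-C), W-slot CT-W, route «WC-TL» ∕ «QR-LL», row **(LT-Δ) «LAYER TRANSPORT»**, part (LT-3b), route (b2) of
# the OWNER gan24-p1 g26's RULING W14 (journal l.40496), file 2 of 2 — THE WEIGHTED THREE-LEG PUSH WITH A PURE-GAUGE LEFT KERNEL LEG through coarse envelopes

NOT IN PRINT; OUR BOOKKEEPING ([folklore] file 1 `LayerPushGaugeLeg` slot by slot after `LayerPushFrozen.push₃_eq_vertexW_sand`, then `LayerPushEntry`'s weighted block count;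
G-an2-4 formalisation swarm, leaf prover `b2b-balaban-gan24-formalise-leaf-01`, gen 63).  HONEST FRAMING (cell contract, verbatim): «discharging `BetaPertH` makes Bałaban's UV stability UNCONDITIONAL — a real constructive-QFT result; it is NOT the
continuum limit and NOT the Clay problem.»  HONEST DEPENDENCY (verbatim): «continuum YM on T⁴ ⇐ BetaPertH ∧ nine spine estimates (0/9 proved); BetaPertH ⇐ (D1) ∧ (D4) ∧
CAP+tail; G-an2-4 gates asym, D1 and NE2/3/4.»

## What (generic `d`, relative blocking `N ≥ 1`, GENERIC legs ∕ weights ∕ families)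
**`abs_push₃_gaugeLeft_le_weighted`**: the left kernel leg a lattice gradient in its fine index, `l α x′ κ₁ x = λ_{αx′}(x + e_{κ₁}) − λ_{αx′}(x)`, with the coarse SUP envelope
`|l α x′ κ₁ x| ≤ Cg·e^{−κ‖quo N x − x′‖₁}` (no gradient envelope asked; the gauge function's own size never enters); right ∕ table legs at sups `Cr`, `Cw`; family with the weighted
slot profile `Cs·ω u·e^{−m(‖x−u‖₁+‖z−u‖₁)}`, `0 < κ < m` ⇒ — with NO frozen term and NO charge hypothesis —
`|push₃ l r w S ν U x′ z′ (inl α) (inl β)| ≤ (d+1)³·(e^{m}+1)·Cw·Cs·Cg·Cr·M₁·Zl(m−κ)·e^{−(κ∕4)(‖x′−U‖₁+‖z′−U‖₁)}·Σ'_u ω u·e^{−(κ∕2)‖quo N u − U‖₁}`.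
READING FOR THE (LT-3) LEDGER (displayed, not claimed beyond the theorem): the gauge leg's SUP `Cg` sits where the pure cell (`LayerTransportCount`) has a GRADIENT constant; so
this cell nets `L^{3(d+1)}·Cw·Cr·Cg·L^d` — equal to the pure cell's `L^{d−4}` only if `Cg ~ L^{−(d+3)}` (gradient-sized); with a sup-sized `Cg ~ L^{−(d+2)}` (the
commissioned (LT-3b-env)) it is `L^{d−3}` = `L^0` at `d = 3` — the located question of the dressed legs' seams (journal R-leaf01-g63-5) in exponent form.
[folklore]; 0 cited facts, 0 `def`, 0 `def … : Prop`, 0 sorry.  NEVER «G-an2-4 closed» as (CONV-C); NOT D1, NOT `BetaPertH`, NOT continuum, NOT Clay.  2026-08-22.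
-/

noncomputable section

open Finset
open scoped BigOperators
open Literature.MathematicalPhysics.QuantumFieldTheory
open Literature.MathematicalPhysics.QuantumFieldTheory.Balaban1983to89
open Literature.MathematicalPhysics.QuantumFieldTheory.Balaban1983to89.Beta
open B12Sec2to5 (l1 l1_nonneg)
open ExpKernelCalculus (MKer Decays comp Zl Zl_nonneg Zl_pos summable_exp_shift summable_exp_shift' tsum_exp_shift' l1_sub_triangle l1_sub_symm)
open OneStepResolventKernel (Fib)
open KKTFluctuationEnergy (tsum_shift tsum_shift_sub)
open Summit.QuantumFields.BalabanUV.Beta.GAN24.LatticeFreeze (summable_mul_of_env abs_tsum_mul_le_of_env mul_exp_neg_le abs_tsum_mul_sub_frozen_le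
  abs_sub_le_of_unit_steps)
open Summit.QuantumFields.BalabanUV.Beta.GAN24.LayerPushEntry (abs_tsum_le_tsum_of_abs_le exp_three_le)
open LatticeForm (quo)
open Summit.QuantumFields.BalabanUV.Beta.GAN24.Push4 (vertexW vertexW_apply Lk Rk ffRead)
open Summit.QuantumFields.BalabanUV.Beta.GAN24.Push3 (push₃)
open Summit.QuantumFields.BalabanUV.Beta.GAN24.Push4TwoRate (summable_leg)
open Summit.QuantumFields.BalabanUV.Beta.GAN24.LayerPushFrozenSlice (exp_wobble leg_rel_sup)
open Summit.QuantumFields.BalabanUV.Beta.GAN24.LayerPushFrozen (sand_inl_inl push₃_eq_vertexW_sand)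

open Summit.QuantumFields.BalabanUV.Beta.GAN24.LayerPushGaugeLeg (abs_gaugeSand_le)

namespace Summit.QuantumFields.BalabanUV.Beta.GAN24.LayerPushGaugeLeft

variable {d : ℕ}

/-! ## The weighted push with a pure-gauge LEFT kernel leg through coarse envelopes -/

section Main

variable {l r w : Fin (d + 1) → (Fin (d + 1) → ℤ) → Fin (d + 1) → (Fin (d + 1) → ℤ) → ℝ}
  {lamL : Fin (d + 1) → (Fin (d + 1) → ℤ) → (Fin (d + 1) → ℤ) → ℝ}
  {S : Fin (d + 1) → (Fin (d + 1) → ℤ) → MKer (d + 1) (Fib d)} {ω : (Fin (d + 1) → ℤ) → ℝ} {N : ℕ} {Cg Cr Cw Cs κ m Ω : ℝ}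

/-- NOT IN PRINT; OUR BOOKKEEPING (§2 slot by slot after `LayerPushFrozen.push₃_eq_vertexW_sand`, then the weighted block count — the (b2) route of the OWNER gan24-p1 g26's
RULING W14, journal l.40496).  **THE WEIGHTED PUSH WITH A PURE-GAUGE LEFT LEG**: the left kernel leg is a lattice gradient in its fine index,
`l α x′ κ₁ x = λ_{αx′}(x + e_{κ₁}) − λ_{αx′}(x)`, whose values obey the coarse envelope `|l α x′ κ₁ x| ≤ Cg·e^{−κ‖quo N x − x′‖₁}` (the SUP of the gauge leg — NO
gradient envelope is asked of it, and the size of the gauge FUNCTION `λ` never enters); right and table legs with sup envelopes `Cr`, `Cw`; family with the weighted slot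
profile `Cs·ω u·e^{−m(‖x−u‖₁+‖z−u‖₁)}`, `0 < κ < m`.  Then — with NO frozen term and NO charge hypothesis —
`|push₃ l r w S ν U x′ z′ (inl α) (inl β)| ≤ (d+1)³·(e^{m}+1)·Cw·Cs·Cg·Cr·M₁·Zl(m−κ)·e^{−(κ∕4)(‖x′−U‖₁+‖z′−U‖₁)}·Σ'_u ω u·e^{−(κ∕2)‖quo N u − U‖₁}`:
`LayerPushEntry.abs_push₃_inl_inl_le_weighted`'s shape with the gauge leg's SUP `Cg` sitting where a Lipschitz allowance would (the telescoping `λ(u)·Σ_x div = 0`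
replaces the charge hypothesis).  In the (LT-3) ledger this cell therefore nets `L^{3(d+1)}·Cg·Cr·Cw·L^d` — one power WORSE than the pure cell unless `Cg` is
GRADIENT-sized (`~L^{−(d+3)}`), which is the located question of the dressed legs (journal R-leaf01-g63-5). -/
theorem abs_push₃_gaugeLeft_le_weighted (hN : 1 ≤ N)
    (hlg : ∀ α x' k x, l α x' k x = lamL α x' (x + Pi.single k (1 : ℤ)) - lamL α x' x)
    (hl : ∀ α x' k x, |l α x' k x| ≤ Cg * Real.exp (-κ * l1 (quo N x - x')))
    (hr : ∀ β z' k z, |r β z' k z| ≤ Cr * Real.exp (-κ * l1 (quo N z - z')))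
    (hw : ∀ ν U k u, |w ν U k u| ≤ Cw * Real.exp (-κ * l1 (quo N u - U)))
    (hS : ∀ k u x z a b, |S k u x z a b| ≤ Cs * ω u * Real.exp (-m * (l1 (x - u) + l1 (z - u))))
    (hω : ∀ u, 0 ≤ ω u ∧ ω u ≤ Ω) (hκ : 0 < κ) (hm : κ < m) (hCg : 0 ≤ Cg) (hCr : 0 ≤ Cr) (hCs : 0 ≤ Cs)
    (ν : Fin (d + 1)) (U x' z' : Fin (d + 1) → ℤ) (α β : Fin (d + 1)) :
    |push₃ l r w S ν U x' z' (Sum.inl α) (Sum.inl β)|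
      ≤ (((d : ℝ) + 1) ^ 3 * (Real.exp m + 1) * Cw * Cs * Cg * Cr * (2 / (m - κ) * Zl (d + 1) ((m - κ) / 2)) * Zl (d + 1) (m - κ)) *
        Real.exp (-(κ / 4) * (l1 (x' - U) + l1 (z' - U))) *
          ∑' u : Fin (d + 1) → ℤ, ω u * Real.exp (-(κ / 2) * l1 (quo N u - U)) := by
  -- (0) constants
  have hκ0 := hκ.le
  have hm0 : 0 < m := hκ.trans hm
  have hmk : 0 < m - κ := sub_pos.2 hm
  have hCw : 0 ≤ Cw := (mul_nonneg_iff_of_pos_right (Real.exp_pos _)).mp ((abs_nonneg _).trans (hw 0 0 0 0))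
  have hΩ : 0 ≤ Ω := (hω 0).1.trans (hω 0).2
  have hZ1 : 0 ≤ Zl (d + 1) (m - κ) := Zl_nonneg hmk
  have hM₁ : 0 ≤ 2 / (m - κ) * Zl (d + 1) ((m - κ) / 2) := by have := Zl_nonneg (D := d + 1) (half_pos hmk); positivity
  have he1 : ∀ (c : ℝ) (v : Fin (d + 1) → ℤ), 0 ≤ c → Real.exp (-c * l1 v) ≤ 1 := fun c v hc =>
    Real.exp_le_one_iff.2 (by nlinarith [l1_nonneg v])
  -- (1) summability and uniform bounds of the legs and of the family
  have hws : ∀ ν' U' k, Summable fun u => w ν' U' k u := fun ν' U' k =>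
    Summable.of_norm_bounded ((summable_leg (d := d) hN hκ U').mul_left Cw) fun u => by rw [Real.norm_eq_abs]; exact hw ν' U' k u
  have hls : ∀ α' x'' k, Summable fun x => l α' x'' k x := fun α' x'' k =>
    Summable.of_norm_bounded ((summable_leg (d := d) hN hκ x'').mul_left Cg) fun x => by rw [Real.norm_eq_abs]; exact hl α' x'' k x
  have hrs : ∀ β' z'' k, Summable fun z => r β' z'' k z := fun β' z'' k =>
    Summable.of_norm_bounded ((summable_leg (d := d) hN hκ z'').mul_left Cr) fun z => by rw [Real.norm_eq_abs]; exact hr β' z'' k z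
  have hlb : ∀ α' x'' k x, |l α' x'' k x| ≤ Cg := fun α' x'' k x =>
    (hl α' x'' k x).trans (mul_le_of_le_one_right hCg (he1 κ _ hκ0))
  have hSb : ∀ k u x z a b, |S k u x z a b| ≤ Cs * Ω := by
    intro k u x z a b
    refine (hS k u x z a b).trans ?_
    have e1 : Real.exp (-m * (l1 (x - u) + l1 (z - u))) ≤ 1 :=
      Real.exp_le_one_iff.2 (by nlinarith [l1_nonneg (x - u), l1_nonneg (z - u)])
    calc Cs * ω u * Real.exp (-m * (l1 (x - u) + l1 (z - u))) ≤ Cs * Ω * 1 :=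
          mul_le_mul (mul_le_mul_of_nonneg_left (hω u).2 hCs) e1 (Real.exp_pos _).le (by positivity)
      _ = Cs * Ω := mul_one _
  have hSd : ∀ k u, Decays (S k u) (Cs * Ω) m := by
    intro k u x z a b
    refine (hS k u x z a b).trans ?_
    have ht : l1 (x - z) ≤ l1 (x - u) + l1 (z - u) := by
      have h := l1_sub_triangle x u z; rw [l1_sub_symm u z] at h; exact h
    have e2 : Real.exp (-m * (l1 (x - u) + l1 (z - u))) ≤ Real.exp (-m * l1 (x - z)) :=
      Real.exp_le_exp.2 (by nlinarith)
    calc Cs * ω u * Real.exp (-m * (l1 (x - u) + l1 (z - u))) ≤ Cs * Ω * Real.exp (-m * l1 (x - z)) :=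
          mul_le_mul (mul_le_mul_of_nonneg_left (hω u).2 hCs) e2 (Real.exp_pos _).le (by positivity)
      _ = Cs * Ω * Real.exp (-m * l1 (x - z)) := rfl
  -- (2) the slot outermost
  rw [push₃_eq_vertexW_sand ν U (hws ν U) hls hrs hlb hCg hSb hSd hm0, vertexW_apply]
  -- (3) per slot: the gauge sandwich
  set A₀ : ℝ := ((d : ℝ) + 1) ^ 2 * (Real.exp m + 1) * Cs * Cg * Cr * (2 / (m - κ) * Zl (d + 1) ((m - κ) / 2)) * Zl (d + 1) (m - κ) with hA₀
  have hA₀0 : 0 ≤ A₀ := by rw [hA₀]; positivity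
  set El : (Fin (d + 1) → ℤ) → ℝ := fun u => Real.exp (-κ * l1 (quo N u - x')) with hEl
  set Er : (Fin (d + 1) → ℤ) → ℝ := fun u => Real.exp (-κ * l1 (quo N u - z')) with hEr
  set EU : (Fin (d + 1) → ℤ) → ℝ := fun u => Real.exp (-κ * l1 (quo N u - U)) with hEU
  set sandE : Fin (d + 1) → (Fin (d + 1) → ℤ) → ℝ := fun k u =>
    ffRead (comp (comp (Lk l) (S k u)) (Rk r)) x' z' (Sum.inl α) (Sum.inl β) with hsandE
  have hKu : ∀ k u x z κ₁ κ₂, |S k u x z (Sum.inl κ₁) (Sum.inl κ₂)| ≤ (Cs * ω u) * Real.exp (-m * (l1 (x - u) + l1 (z - u))) :=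
    fun k u x z κ₁ κ₂ => (hS k u x z _ _).trans (le_of_eq (by ring))
  -- the gauge function's Lipschitz allowance from the gauge leg's sup (unit steps = leg values)
  have hlamLip : ∀ u x, |lamL α x' x - lamL α x' u| ≤ Cg * El u * l1 (x - u) * Real.exp (κ * l1 (x - u)) := by
    intro u x
    refine abs_sub_le_of_unit_steps (f := lamL α x') (u := u) (by positivity) hκ0 (fun p i => ?_) x
    rw [← hlg α x' i p]
    calc |l α x' i p| ≤ Cg * Real.exp (-κ * l1 (quo N p - x')) := hl α x' i p
      _ ≤ Cg * (Real.exp (κ * l1 (p - u)) * Real.exp (-κ * l1 (quo N u - x'))) := mul_le_mul_of_nonneg_left (exp_wobble hN hκ0 p u x') hCg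
      _ = Cg * El u * Real.exp (κ * l1 (p - u)) := by ring
  have hru : ∀ u κ₂ z, |r β z' κ₂ z| ≤ Cr * Er u * Real.exp (κ * l1 (z - u)) := fun u κ₂ z =>
    leg_rel_sup hN hκ0 hCr (f := fun k z => r β z' k z) (fun k z => hr β z' k z) u κ₂ z
  have hEl1 : ∀ u, El u ≤ 1 := fun u => he1 κ _ hκ0
  have hEr1 : ∀ u, Er u ≤ 1 := fun u => he1 κ _ hκ0
  have hsand : ∀ k u, |sandE k u| ≤ A₀ * ω u * (El u * Er u) := by
    intro k u
    have hω0 := (hω u).1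
    rw [hsandE]
    simp only []
    rw [sand_inl_inl]
    have e1 : (∑' z : Fin (d + 1) → ℤ, ∑ κ₂ : Fin (d + 1), (∑' x : Fin (d + 1) → ℤ, ∑ κ₁ : Fin (d + 1),
          l α x' κ₁ x * S k u x z (Sum.inl κ₁) (Sum.inl κ₂)) * r β z' κ₂ z)
        = ∑' z : Fin (d + 1) → ℤ, ∑ κ₂ : Fin (d + 1), (∑' x : Fin (d + 1) → ℤ, ∑ κ₁ : Fin (d + 1),
          (lamL α x' (x + Pi.single κ₁ (1 : ℤ)) - lamL α x' x) * S k u x z (Sum.inl κ₁) (Sum.inl κ₂)) * r β z' κ₂ z := by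
      simp only [hlg]
    rw [e1]
    have h := abs_gaugeSand_le (lam := lamL α x') (rz := fun κ₂ z => r β z' κ₂ z) (K := S k u) (u := u)
      hm hκ0 (by positivity : 0 ≤ Cs * ω u) (by positivity : 0 ≤ Cg * El u) (abs_nonneg (lamL α x' u)) (by positivity : 0 ≤ Cr * Er u)
      (hKu k u) le_rfl (hlamLip u) (hru u)
    refine h.trans (le_of_eq ?_)
    rw [hA₀]; ring
  have hsumS : ∀ k, Summable fun u => w ν U k u * sandE k u := fun k =>
    Summable.of_norm_bounded ((summable_leg (d := d) hN hκ U).mul_left (Cw * (A₀ * Ω))) fun u => by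
      rw [Real.norm_eq_abs, abs_mul]
      have hω0 := (hω u).1
      have h1 : A₀ * ω u * (El u * Er u) ≤ A₀ * Ω := by
        calc A₀ * ω u * (El u * Er u) ≤ A₀ * ω u * 1 := by
              refine mul_le_mul_of_nonneg_left ?_ (by positivity)
              calc El u * Er u ≤ 1 * 1 := mul_le_mul (hEl1 u) (hEr1 u) (Real.exp_pos _).le zero_le_one
                _ = 1 := one_mul _
          _ ≤ A₀ * Ω := by rw [mul_one]; exact mul_le_mul_of_nonneg_left (hω u).2 hA₀0
      calc |w ν U k u| * |sandE k u| ≤ (Cw * Real.exp (-κ * l1 (quo N u - U))) * (A₀ * Ω) :=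
            mul_le_mul (hw ν U k u) ((hsand k u).trans h1) (abs_nonneg _) (by positivity)
        _ = _ := by ring
  -- (4) the slot series against the weighted block count
  have hg0 : ∀ u, 0 ≤ ω u * Real.exp (-(κ / 2) * l1 (quo N u - U)) := fun u => by have := (hω u).1; positivity
  have hgs : Summable fun u => ω u * Real.exp (-(κ / 2) * l1 (quo N u - U)) := by
    refine Summable.of_nonneg_of_le hg0 (fun u => ?_) ((summable_leg (d := d) hN (half_pos hκ) U).mul_left Ω)
    exact mul_le_mul_of_nonneg_right (hω u).2 (Real.exp_pos _).le
  have hτ : min (κ / 4) κ = κ / 4 := min_eq_left (by linarith)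
  have hslot : ∀ k, |∑' u, w ν U k u * sandE k u|
      ≤ (Cw * A₀ * Real.exp (-(κ / 4) * (l1 (x' - U) + l1 (z' - U)))) * ∑' u, ω u * Real.exp (-(κ / 2) * l1 (quo N u - U)) := by
    intro k
    rw [← tsum_mul_left]
    refine abs_tsum_le_tsum_of_abs_le (fun u => ?_) (hgs.mul_left _)
    rw [abs_mul]
    have h3 := exp_three_le (d := d) hκ0 hκ0 (quo N u) U x' z'
    rw [hτ] at h3
    have hω0 := (hω u).1
    calc |w ν U k u| * |sandE k u| ≤ (Cw * EU u) * (A₀ * ω u * (El u * Er u)) :=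
          mul_le_mul (hw ν U k u) (hsand k u) (abs_nonneg _) (by positivity)
      _ = Cw * A₀ * ω u * (EU u * El u * Er u) := by ring
      _ ≤ Cw * A₀ * ω u * (Real.exp (-(κ / 2) * l1 (quo N u - U)) * Real.exp (-(κ / 4) * (l1 (x' - U) + l1 (z' - U)))) :=
          mul_le_mul_of_nonneg_left h3 (by positivity)
      _ = _ := by ring
  calc |∑ k : Fin (d + 1), ∑' u, w ν U k u * sandE k u|
      ≤ ∑ k : Fin (d + 1), |∑' u, w ν U k u * sandE k u| := Finset.abs_sum_le_sum_abs _ _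
    _ ≤ ∑ _k : Fin (d + 1), (Cw * A₀ * Real.exp (-(κ / 4) * (l1 (x' - U) + l1 (z' - U)))) *
          ∑' u, ω u * Real.exp (-(κ / 2) * l1 (quo N u - U)) := Finset.sum_le_sum fun k _ => hslot k
    _ = _ := by
        simp only [Finset.sum_const, Finset.card_univ, Fintype.card_fin, nsmul_eq_mul, hA₀]
        push_cast
        ring

end Main

end Summit.QuantumFields.BalabanUV.Beta.GAN24.LayerPushGaugeLeft

end
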